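import Mathlib
import Summits.ResolutionOfSingularities.ResolutionOfSingularities.Theorems.RadicialJungCleanModelsLens5PRankTwoPort5
import Literature.FieldTheory.Separability.PDegreeSeparablyGenerated
import Literature.FieldTheory.Separability.PIndependentDerivations
import HarnessLib

/-!
# Lens 5 — THEOREM T⁗″ (the count `[K : K^p] = p^{r+3}` in kernel) and THEOREM T⁗‴ (the CANONICAL slice of `stub_cleanLU3DefectNonDiscrete`:
# (P2) ∧ `[k : k^p] = p^r` ∧ `[κ_v : κ_v^p] = p^r` — two `p`-degrees, no frame data), modulo only F-02/F-32

OURS · CANDIDATE · counted 0.  Crux workfile on `stmt-ResolutionOfSingularities-0549` (`Theses.Descent.DescentPerfectToAll`); customer =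
the lead's research stub `stub_cleanLU3DefectNonDiscrete` of `Cruxes/CleanModels/Lines/Sketch.lean` (rev 28 :279).  Nothing here proves
resolution in char `p`; resolution in char p NOT proved.  Four levels below the crux: T⁗″ ⊂ :279 ⊂ :219 ⊂ `CleanModels|_{dim ≥ 4}` ⊂ 0549.

## What T⁗″ says (res-B-lens-5 g15)
THEOREM T⁗′ (`Lens5_TFrame.lean` rev 3 §I, kernel modulo F-02/F-32: `cleanLU3DefectPRankTwoPMon_of_cossartPiltant2019`) settles the lead's stub
on {(P2) `[Γ : pΓ] = p²`, `k` of finite `p`-rank, `r` elements `w_i ∈ O_v` with residually `p`-independent `p`-monomials, `[K : K^p] = p^{r+3}`}.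
Its one hypothesis not read off the valuation is the COUNT `[K : K^p] = p^{r+3}`, which by hand is «`r = [k : k^p]_p`» (Becker–MacLane:
the degree of imperfection of a function field of transcendence degree `3` over `k` is that of `k` plus `3`, whether or not `K/k` is
separably generated).  This file proves the count IN KERNEL (§A–§C) and restates the slice with a finite `p`-BASIS `β : Fin r → k` of `k`
in place of the count (§D `CleanLU3DefectPRankTwoPBasisAt`):
  (P2) ∧ `k = k^p[β]` (`β` `p`-spans through its `p`-monomials and is `p`-free) ∧ `w : Fin r → O_v` with `pMonomial p w` residually
  `p`-independent  ⟹  `CleanLUConcl` (clean form (3), `c' = 0`),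
i.e. exactly «(P2), `k` of finite `p`-rank `r`, and `[κ_v : κ_v^p] ≥ p^r`» — under :279's hypotheses `κ_v/k` is algebraic ((P2) + `htd`,
✓ currency §K) and then `[κ_v : κ_v^p] ≤ [k : k^p]` by hand (memo §23.2 (b)), so this is the slice `[κ_v : κ_v^p] = [k : k^p] < ∞`, the exact
complement of the residual class (R2′) (`p`-radically deficient residue fields) inside {(P2), finite `p`-rank}.  `r = 0` (`k` perfect) is THEOREM T.

## What T⁗‴ says (rev 3, §E–§H): the canonical slice
`CleanLU3DefectPRankTwoPDegAt p`: :279's binders → (P2) → `∀ r, [k : k^p] = p^r → [κ_v : κ_v^p] = p^r → CleanLUConcl`, the two `p`-degrees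
being `Module.finrank` over `Subfield.closure (range (· ^ p))` of `k` and of `κ_v := IsLocalRing.ResidueField O_v`.  PROVED from T⁗″'s slice
(`cleanLU3DefectPRankTwoPDeg_of_pBasis`, hence from T⁗′'s: `cleanLU3DefectPRankTwoPDeg_of_pMon`) by PRODUCING the frame data in kernel:
§E the `p`-monomials of a finite family span `E^p(β)` over `E^p` and, for `β` `p`-independent, are `E^p`-linearly independent (count
`p^r = [E^p(β) : E^p]`); §F `[E : E^p] = p^r` ⟹ a `p`-basis `β : Fin r → E` (✓ `exists_isPIndependent_adjoin_eq_top` + finiteness by degree),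
whose `p`-monomials `p`-span and which is `p`-free (linear disjointness ✓ `adjoin_inf_adjoin_eq_bot_of_isPIndependent`); §G lifts `w_i ∈ O_v`
of a `p`-basis of `κ_v/κ_v^p` have residually `p`-independent `p`-monomials (reduce `Σ_e w'_e^p W_e` mod `𝔪_v` and use §E's independence).
So the settled region of lens 5 in finite `p`-rank is, IN KERNEL and with no by-hand rider: {(P2) ∧ `[κ_v : κ_v^p] = [k : k^p] < ∞`} — by memo §27
exactly the valuations of minimal defect `d(K|K^p, v) = p`.

## The count (§A–§C; no separability anywhere)
§A `[K : K^p] = [F : F^p]` for `K/F` finite (towers `F^p ⊆ F ⊆ K`, `F^p ⊆ K^p ⊆ K` inside `K`; Frobenius `K ≅ K^p` over `F ≅ F^p`).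
§B `[F : F^p] = p^{r + #s}` for `F = k(s)` purely transcendental: `β ∪ s` is a `p`-basis of `F` — it `p`-generates (`k = k^p[β]`), and it is
`p`-independent over `F^p` by DUAL DERIVATIONS (`∂/∂s_a`, ✓ `exists_derivation_dual`; the `ℤ`-derivations of `k` dual to `β`,
✓ `exists_derivation_eq_one_eqOn_zero`, extended to `F` along the formally smooth `k → k(s)` by ✓ `Derivation.exists_extension_of_formallySmooth`
and corrected by `Σ_a Δ(s_a) ∂/∂s_a`; exchange lemma ✓ `isPIndependent_insert`).
§C `K = Frac A`, `A` finitely generated of Krull dimension `3` over `k`: a transcendence basis `s` has three elements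
(✓ `exists_ringKrullDim_eq_and_trdeg_eq`), `K/k(s)` is finite, so `[K : K^p] = [k(s) : k(s)^p] = p^{r+3}`.

## Status of this file (rev 3, res-B-lens-5 g15): SORRY-FREE (`lean check` rc 0, 0 sorries, 0 warnings; no linter disabled except `dupNamespace` — port-clean; axioms standard)
§0 currencies (token-identical copies of `Lens5_TFrame.lean` §B′/§I: `IsPSpanningFamily`, `ResiduallyPIndependentFamily`, `pMonomial`,
`CleanLU3DefectPRankTwoPMonAt` — crux workfiles are not importable; the porter replaces the copies by the import); §A–§C the count (PROVED);
§D `def CleanLU3DefectPRankTwoPBasisAt` + `cleanLU3DefectPRankTwoPBasis_of_pMon : CleanLU3DefectPRankTwoPMonAt p → CleanLU3DefectPRankTwoPBasisAt p`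
(PROVED); §E–§G `p`-monomial bases / `p`-basis extraction / residual lifts (PROVED); §H `def CleanLU3DefectPRankTwoPDegAt` +
`cleanLU3DefectPRankTwoPDeg_of_pBasis : CleanLU3DefectPRankTwoPBasisAt p → CleanLU3DefectPRankTwoPDegAt p` + `cleanLU3DefectPRankTwoPDeg_of_pMon` (PROVED).  Composition with T⁗′ (`CleanLU3DefectPRankTwoPMonAt p` ⟸ `CossartPiltant2019` + F-32, ✓ in `Lens5_TFrame.lean` rev 3) happens at port
time, as for T″.  NOT counted (crux workfile, four levels below 0549); resolution in char p NOT proved.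

## Residual of the lead's stub after T ∪ T′ ∪ T″ ∪ T‴ ∪ T⁗ ∪ T⁗′ ∪ T⁗″ ∪ T⁗‴ (honest; memo §23–§28)
(R1) {`[Γ : pΓ] ≤ p`} (no grading — memo §11) ∪ (R2′) {finite `p`-rank, (P2), `[κ_v : κ_v^p] < [k : k^p]`} (`p`-radically deficient residue
field; no frame exists) ∪ (R3) {infinite `p`-rank beyond T″/T‴}.  Inputs left: F-02 (`CossartPiltant2019`) and F-32 (`hEmb`).
-/

set_option linter.dupNamespace false -- mandated namespace of this single-conjunct summit

noncomputable section

section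

open IsLocalRing IntermediateField Module MvPolynomial
open Literature.AlgebraicGeometry.Resolution
open Summit.ResolutionOfSingularities.ResolutionOfSingularities.Theorems.RadicialJung.CleanModels
open Summit.ResolutionOfSingularities.ResolutionOfSingularities.Theorems.RadicialJung.CleanModels.Lens5
open Summit.ResolutionOfSingularities.ResolutionOfSingularities.Theorems.RadicialJung.CleanModels.Lens5.PRankTwoCurrency
open Summit.ResolutionOfSingularities.ResolutionOfSingularities.Theorems.RadicialJung.CleanModels.Lens5.PRankTwoAssembly

namespace Summit.ResolutionOfSingularities.ResolutionOfSingularities.Cruxes.DescentPerfectToAll.CpSibling.PDegreeCount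

/-! ## §0 Currencies (token-identical copies of `Lens5_TFrame.lean` §B′ / §I) -/

/-- **A finite family `p`-spans `k`**: `k = Σ_s k^p b_s`, i.e. finite `p`-rank (token-identical with `Lens5_TFrame.lean` §B′). [folklore] -/
def IsPSpanningFamily (p : ℕ) {k : Type} [Field k] {S : Type} [Fintype S] (b : S → k) : Prop :=
    ∀ c : k, ∃ d : S → k, c = ∑ s : S, d s ^ p * b s

/-- **Residual `p`-independence of a finite family** `B : S → K` along `v` (token-identical with `Lens5_TFrame.lean` §B′). [folklore] -/
def ResiduallyPIndependentFamily (p : ℕ) {K : Type} [Field K] (O : ValuationSubring K) {S : Type} [Fintype S]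
    (B : S → K) : Prop :=
    ∀ w : S → K, (∀ s, w s ∈ O) → (∃ s, O.valuation (w s) = 1) → O.valuation (∑ s : S, w s ^ p * B s) = 1

/-- The `p`-monomials `W_e := ∏ i, w_i ^ {e_i}` (`0 ≤ e_i < p`) of a finite family (token-identical with `Lens5_TFrame.lean` §I). [folklore] -/
def pMonomial (p : ℕ) {K : Type} [Field K] {r : ℕ} (w : Fin r → K) (e : Fin r → Fin p) : K := ∏ i, w i ^ (e i : ℕ)

/-- **THEOREM T⁗′'s slice** (`p`-monomial frames; token-identical with `Lens5_TFrame.lean` §I, ✓ there modulo F-02/F-32 as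
`cleanLU3DefectPRankTwoPMon_of_cossartPiltant2019`). [folklore] -/
def CleanLU3DefectPRankTwoPMonAt (p : ℕ) : Prop :=
    ∀ (k : Type) [Field k] [CharP k p] (K : Type) [Field K] [Algebra k K]
    (O : ValuationSubring K) (A : Subalgebra k K), A.toSubring ≤ O.toSubring → A.FG → IsFractionRing A K →
    ringKrullDim A ≤ 3 → IsRegularLocalRing (locAtCentre A.toSubring O) →
    ringKrullDim (locAtCentre A.toSubring O) = 3 →
    (∀ (T : Subring K) (hT : T ≤ O.toSubring), A.toSubring ≤ T → (subringCentre T O hT).IsMaximal) →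
    ∀ g₀ : K, (∀ c : K, c ^ p ≠ g₀) →
    (∀ f₀ : K, ∃ f₁ : K, O.valuation (g₀ - f₁ ^ p) < O.valuation (g₀ - f₀ ^ p)) →
    (∀ hk : ∀ c : k, algebraMap k K c ∈ O, transcendenceDefect k O hk ≠ 0) →
    ¬ (∃ π : K, π ≠ 0 ∧ (∀ x : K, O.valuation x < 1 → O.valuation x ≤ O.valuation π) ∧
      (∀ x : K, x ≠ 0 → ∃ n : ℕ, O.valuation π ^ n ≤ O.valuation x)) →
    PRankTwoAt p O →
    ∀ (Sb : Type) [Fintype Sb] (b : Sb → k), IsPSpanningFamily p b →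
    ∀ (r : ℕ) (w : Fin r → K), (∀ i, w i ∈ O) → ResiduallyPIndependentFamily p O (pMonomial p w) →
    Module.finrank (Subfield.closure (Set.range (fun x : K => x ^ p))) K = p ^ (r + 3) →
    CleanLUConcl p k K O A g₀

/-! ## §B The `p`-degree of a purely transcendental extension over a ground field with a finite `p`-basis -/

section PurelyTranscendental

variable {k : Type} [Field k] {F : Type} [Field F] [Algebra k F] (p : ℕ) [Fact p.Prime] [CharP F p]

/-- A `ℤ`-derivation killing a set kills the subfield `F^p(t)` it generates together with the `p`-th powers. [folklore] -/
theorem derivation_eq_zero_of_mem_adjoin_frobenius (D : Derivation ℤ F F) {t : Set F}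
    (ht : ∀ b ∈ t, D b = 0) {x : F} (hx : x ∈ adjoin (frobenius F p).fieldRange t) : D x = 0 := by
  have hx' : x ∈ Subfield.closure (Set.range (algebraMap (frobenius F p).fieldRange F) ∪ t) := by
    rwa [← adjoin_toSubfield]
  have h := Literature.FieldTheory.Separability.Derivation.eqOn_subfieldClosure (D₁ := D) (D₂ := 0)
    (s := Set.range (algebraMap (frobenius F p).fieldRange F) ∪ t) ?_ hx'
  · simpa using h
  · rintro y (⟨c, rfl⟩ | hy)
    · obtain ⟨z, hz⟩ := RingHom.mem_fieldRange.mp c.2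
      change D (c : F) = (0 : Derivation ℤ F F) _
      rw [Derivation.zero_apply, ← hz, frobenius_def]
      exact Literature.FieldTheory.Separability.Derivation.apply_pow_char (p := p) D z
    · rw [Derivation.zero_apply]
      exact ht y hy

/-- **Dual derivations ⇒ `p`-independence over `F^p`**: a finite set carrying `ℤ`-derivations `δ_a` with `δ_a(a) = 1`, `δ_a(b) = 0`
(`b ≠ a` in the set) is `p`-independent over `F^p` (exchange lemma, induction on the set). [cite: Matsumura1987, §26 p. 202] -/
theorem isPIndependent_of_dual (t : Finset F) (δ : F → Derivation ℤ F F)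
    (hδ : ∀ a ∈ t, δ a a = 1 ∧ ∀ b ∈ t, b ≠ a → δ a b = 0) :
    Literature.AlgebraicGeometry.Resolution.IsPIndependent (F := (frobenius F p).fieldRange) p (t : Set F) := by
  classical
  suffices h : ∀ u : Finset F, u ⊆ t →
      Literature.AlgebraicGeometry.Resolution.IsPIndependent (F := (frobenius F p).fieldRange) p (u : Set F) from
    h t subset_rfl
  intro u
  induction u using Finset.induction_on with
  | empty =>
    intro _
    rw [Finset.coe_empty]
    exact Literature.AlgebraicGeometry.Resolution.isPIndependent_empty _ p
  | insert a u hau ih =>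
    intro hut
    have hut' : u ⊆ t := fun x hx => hut (Finset.mem_insert_of_mem hx)
    have hat : a ∈ t := hut (Finset.mem_insert_self a u)
    rw [Finset.coe_insert]
    refine Literature.AlgebraicGeometry.Resolution.isPIndependent_insert (ih hut') ?_
      ⟨⟨a ^ p, RingHom.mem_fieldRange.mpr ⟨a, frobenius_def ..⟩⟩, rfl⟩
    intro hmem
    have hDu : ∀ b ∈ (u : Set F), δ a b = 0 := fun b hb =>
      (hδ a hat).2 b (hut' hb) (fun h => hau (h ▸ (Finset.mem_coe.mp hb)))
    have := derivation_eq_zero_of_mem_adjoin_frobenius p (δ a) hDu hmem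
    rw [(hδ a hat).1] at this
    exact one_ne_zero this

/-- **`[F : F^p] = p^{r + #s}` for `F = k(s)` purely transcendental over a ground field `k` with a `p`-basis of `r` elements**
(`β` `p`-spans `k` through its `p`-monomials and is `p`-free).  The `r + #s` elements `β ∪ s` form a `p`-basis of `F`: they `p`-generate
(`k = k^p[β] ⊆ F^p(β)`), and they are `p`-independent by DUAL DERIVATIONS — `∂/∂s_a` (the `k`-derivations of `k(s)`), and the derivations
`Δ_j` of `k` dual to `β` (Matsumura §26) extended to `k(s)` along the formally smooth `k → k[X_s] → k(s)` and corrected by `Σ_a Δ_j(s_a) ∂/∂s_a`.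
Degree of imperfection is additive: `+1` per transcendental (Becker–MacLane 1940). [cite: Matsumura1987, §26 p. 202, Thm. 26.5, Thm. 26.10] -/
theorem finrank_frobenius_purelyTranscendental [CharP k p] (s : Finset F) (hs : AlgebraicIndependent k ((↑) : s → F))
    (htop : adjoin k (s : Set F) = ⊤)
    {r : ℕ} (β : Fin r → k) (hβspan : IsPSpanningFamily p (pMonomial p β))
    (hβfree : ∀ i, β i ∉ Subfield.closure (Set.range (fun x : k => x ^ p) ∪ β '' ({i}ᶜ : Set (Fin r)))) :
    finrank (frobenius F p).fieldRange F = p ^ (r + s.card) := by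
  classical
  have hp : p.Prime := Fact.out
  haveI : ExpChar F p := ExpChar.prime hp
  set Fp := (frobenius F p).fieldRange with hFpdef
  -- ### the `k`-derivations `∂_a` dual to `s` (`k(s)/k(s)` is separable)
  have hsep : Algebra.IsSeparable (adjoin k (s : Set F)) F := by
    rw [htop]
    exact ⟨fun x => isSeparable_algebraMap (⟨x, trivial⟩ : (⊤ : IntermediateField k F))⟩
  have hds := fun a : s => Literature.FieldTheory.Separability.exists_derivation_dual s hs hsep a
  choose ds hds1 hds0 using hds
  -- ### `k → F` is formally smooth (`F ≅ Frac k[X_s]`)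
  let A := MvPolynomial (s : Type) k
  let L₀ : IntermediateField k F := adjoin k (s : Set F)
  have hrange : Set.range ((↑) : s → F) = (s : Set F) := Subtype.range_coe
  let e : FractionRing A ≃ₐ[k] L₀ := hs.aevalEquivField.trans (equivOfEq (by rw [hrange]))
  letI algAL : Algebra A L₀ := ((e : FractionRing A →+* L₀).comp (algebraMap A (FractionRing A))).toAlgebra
  have halgAL : ∀ a : A, algebraMap A L₀ a = e (algebraMap A (FractionRing A) a) := fun _ => rfl
  let e' : FractionRing A ≃ₐ[A] L₀ := AlgEquiv.ofRingEquiv (f := (e : FractionRing A ≃+* L₀)) (fun a => (halgAL a).symm)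
  haveI : IsFractionRing A L₀ := IsLocalization.isLocalization_of_algEquiv (nonZeroDivisors A) e'
  haveI : Algebra.FormallySmooth A L₀ := Algebra.FormallySmooth.of_isLocalization (nonZeroDivisors A)
  haveI : IsScalarTower k A L₀ := IsScalarTower.of_algebraMap_eq fun c => by
    rw [halgAL, ← IsScalarTower.algebraMap_apply k A (FractionRing A) c, AlgEquiv.commutes]
  haveI : Algebra.FormallySmooth k L₀ := Algebra.FormallySmooth.comp k A L₀
  let etop : L₀ ≃ₐ[k] F := (equivOfEq htop).trans topEquiv
  haveI : Algebra.FormallySmooth k F := Algebra.FormallySmooth.of_equiv etop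
  -- ### the derivations `Δ_j` dual to `β`, extended to `F` and corrected
  have hΔ : ∀ j : Fin r, ∃ D : Derivation ℤ F F, D (algebraMap k F (β j)) = 1 ∧
      (∀ l : Fin r, l ≠ j → D (algebraMap k F (β l)) = 0) ∧ ∀ a : s, D (a : F) = 0 := by
    intro j
    haveI : CharP k p := inferInstance
    obtain ⟨D₀, hD₀1, hD₀0⟩ := Literature.FieldTheory.Separability.exists_derivation_eq_one_eqOn_zero p
      (Subfield.closure (Set.range (fun x : k => x ^ p) ∪ β '' ({j}ᶜ : Set (Fin r))))
      (fun x => Subfield.subset_closure (Or.inl ⟨x, rfl⟩)) (hβfree j)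
    let d : Derivation ℤ k F := (Algebra.linearMap k F).compDer D₀
    have hd : ∀ c : k, d c = algebraMap k F (D₀ c) := fun _ => rfl
    obtain ⟨D₁, hD₁⟩ := Literature.NumberTheory.Transcendental.Derivation.exists_extension_of_formallySmooth
      (R := ℤ) (S := k) (T := F) (M := F) d
    let D : Derivation ℤ F F := D₁ - ∑ a : s, (D₁ (a : F)) • (ds a).restrictScalars ℤ
    have hDapply : ∀ x : F, D x = D₁ x - ∑ a : s, D₁ (a : F) * ds a x := by
      intro x
      simp only [D, Derivation.sub_apply, Literature.FieldTheory.Separability.Derivation.finset_sum_apply,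
        Derivation.smul_apply, Derivation.restrictScalars_apply, smul_eq_mul]
    refine ⟨D, ?_, fun l hl => ?_, fun a => ?_⟩
    · rw [hDapply, hD₁, hd, hD₀1, map_one, Finset.sum_eq_zero fun a _ => by rw [Derivation.map_algebraMap, mul_zero], sub_zero]
    · rw [hDapply, hD₁, hd, hD₀0 _ (Subfield.subset_closure (Or.inr ⟨l, hl, rfl⟩)), map_zero,
        Finset.sum_eq_zero fun a _ => by rw [Derivation.map_algebraMap, mul_zero], sub_zero]
    · rw [hDapply, Finset.sum_eq_single a, hds1, mul_one, sub_self]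
      · intro b _ hba; rw [hds0 b a hba.symm, mul_zero]
      · intro h; exact absurd (Finset.mem_univ a) h
  choose Δ hΔ1 hΔ0 hΔs using hΔ
  -- ### the images of `β` are off `s` and pairwise distinct
  have hβs : ∀ j, algebraMap k F (β j) ∉ s := by
    intro j hj
    have h1 := hds1 ⟨_, hj⟩
    rw [Derivation.map_algebraMap] at h1
    exact zero_ne_one h1
  have hβinj : Function.Injective fun j => algebraMap k F (β j) := by
    intro j l hjl
    by_contra hne
    have h0 := hΔ0 l j hne
    rw [show algebraMap k F (β j) = algebraMap k F (β l) from hjl, hΔ1 l] at h0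
    exact one_ne_zero h0
  -- ### the `p`-basis `t := s ∪ β`
  set tβ : Finset F := Finset.univ.image fun j => algebraMap k F (β j) with htβ
  set t : Finset F := s ∪ tβ with htdef
  have hdisj : Disjoint s tβ := by
    rw [Finset.disjoint_right]
    intro x hx
    obtain ⟨j, _, rfl⟩ := Finset.mem_image.mp hx
    exact hβs j
  have hcard : t.card = r + s.card := by
    rw [htdef, Finset.card_union_of_disjoint hdisj, htβ, Finset.card_image_of_injective _ hβinj, Finset.card_univ,
      Fintype.card_fin, add_comm]
  -- dual derivations on `t`
  let δ : F → Derivation ℤ F F := fun x =>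
    if hx : x ∈ s then (ds ⟨x, hx⟩).restrictScalars ℤ
    else if hj : ∃ j, algebraMap k F (β j) = x then Δ hj.choose else 0
  have hδ : ∀ a ∈ t, δ a a = 1 ∧ ∀ b ∈ t, b ≠ a → δ a b = 0 := by
    intro a ha
    rcases Finset.mem_union.mp ha with has | hat
    · refine ⟨by simp only [δ, dif_pos has, Derivation.restrictScalars_apply]; exact hds1 ⟨a, has⟩, fun b hb hba => ?_⟩
      simp only [δ, dif_pos has, Derivation.restrictScalars_apply]
      rcases Finset.mem_union.mp hb with hbs | hbt
      · exact hds0 ⟨a, has⟩ ⟨b, hbs⟩ (fun h => hba (congrArg Subtype.val h))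
      · obtain ⟨j, _, rfl⟩ := Finset.mem_image.mp hbt
        exact Derivation.map_algebraMap _ _
    · obtain ⟨j, _, rfl⟩ := Finset.mem_image.mp hat
      have hns : algebraMap k F (β j) ∉ s := hβs j
      have hex : ∃ l, algebraMap k F (β l) = algebraMap k F (β j) := ⟨j, rfl⟩
      have hch : hex.choose = j := hβinj hex.choose_spec
      refine ⟨?_, fun b hb hba => ?_⟩
      · simp only [δ, dif_neg hns, dif_pos hex]
        rw [hch]; exact hΔ1 j
      · simp only [δ, dif_neg hns, dif_pos hex]
        rw [hch]
        rcases Finset.mem_union.mp hb with hbs | hbt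
        · exact hΔs j ⟨b, hbs⟩
        · obtain ⟨l, _, rfl⟩ := Finset.mem_image.mp hbt
          exact hΔ0 j l (fun h => hba (by rw [h]))
  have hPI := isPIndependent_of_dual p t δ hδ
  -- ### `F = F^p(t)`
  have htop' : adjoin Fp (t : Set F) = ⊤ := by
    rw [eq_top_iff]
    intro x _
    have hx : x ∈ (adjoin k (s : Set F)).toSubfield := by rw [htop]; trivial
    rw [adjoin_toSubfield] at hx
    have hsub : Set.range (algebraMap k F) ∪ (s : Set F) ⊆ ((adjoin Fp (t : Set F)).toSubfield : Set F) := by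
      rintro z (⟨c, rfl⟩ | hz)
      · obtain ⟨d, hd⟩ := hβspan c
        rw [hd, map_sum]
        refine sum_mem fun e _ => ?_
        rw [map_mul, map_pow]
        refine mul_mem ?_ ?_
        · exact (adjoin Fp (t : Set F)).algebraMap_mem ⟨_, RingHom.mem_fieldRange.mpr ⟨algebraMap k F (d e), frobenius_def ..⟩⟩
        · unfold pMonomial
          rw [map_prod]
          refine prod_mem fun i _ => ?_
          rw [map_pow]
          exact pow_mem (subset_adjoin Fp (t : Set F)
            (Finset.mem_coe.mpr (Finset.mem_union_right _ (Finset.mem_image.mpr ⟨i, Finset.mem_univ _, rfl⟩)))) _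
      · exact subset_adjoin Fp (t : Set F) (Finset.mem_coe.mpr (Finset.mem_union_left _ (Finset.mem_coe.mp hz)))
    exact Subfield.closure_le.mpr hsub hx
  have h1 := hPI.finrank_eq t subset_rfl
  rw [htop', finrank_top', hcard] at h1
  exact h1

end PurelyTranscendental


/-! ## §A The `p`-degree is invariant under finite extensions -/

/-- **`[K : K^p] = [F : F^p]` for a finite extension `K/F`** of fields of characteristic `p` (count `[K : F^p]` along `F^p ⊆ F ⊆ K` and
`F^p ⊆ K^p ⊆ K`; Frobenius gives `[K^p : F^p] = [K : F]`).  With the convention `finrank = 0` for infinite degree the identity holds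
verbatim (both sides vanish together). [cite: Matsumura1987, §26 Thm. 26.10] [folklore] -/
theorem finrank_frobenius_eq_of_finite {F K : Type} [Field F] [Field K] [Algebra F K] (p : ℕ) [Fact p.Prime]
    [CharP F p] [CharP K p] [Module.Finite F K] :
    finrank (frobenius K p).fieldRange K = finrank (frobenius F p).fieldRange F := by
  classical
  have hp : p.Prime := Fact.out
  set φ := algebraMap F K with hφdef
  have hφ : Function.Injective φ := φ.injective
  -- the subfields `K^p`, `F` (image) and `F^p` (image) of `K`
  set Kp : Subfield K := (frobenius K p).fieldRange with hKpdef
  set F₁ : Subfield K := φ.fieldRange with hF₁def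
  set F₀ : Subfield K := (φ.comp (frobenius F p)).fieldRange with hF₀def
  have hφp : ∀ x : F, φ (x ^ p) = frobenius K p (φ x) := fun x => by rw [map_pow, frobenius_def]
  have hF₀F₁ : F₀ ≤ F₁ := by
    rintro z hz
    obtain ⟨x, rfl⟩ := RingHom.mem_fieldRange.mp hz
    exact RingHom.mem_fieldRange.mpr ⟨x ^ p, by rw [RingHom.comp_apply, frobenius_def]⟩
  have hF₀Kp : F₀ ≤ Kp := by
    rintro z hz
    obtain ⟨x, rfl⟩ := RingHom.mem_fieldRange.mp hz
    exact RingHom.mem_fieldRange.mpr ⟨φ x, by rw [RingHom.comp_apply, frobenius_def, frobenius_def, map_pow]⟩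
  -- everything over the base field `B := F^p ⊆ K`
  let F₁' : IntermediateField F₀ K := F₁.toIntermediateField fun x => hF₀F₁ x.2
  let Kp' : IntermediateField F₀ K := Kp.toIntermediateField fun x => hF₀Kp x.2
  have htower₁ := Module.finrank_mul_finrank F₀ F₁' K
  have htower₂ := Module.finrank_mul_finrank F₀ Kp' K
  -- (T1) `[K : F] = [K : F₁']`
  let i₁ : F →+* F₁' := φ.codRestrict F₁' fun x => RingHom.mem_fieldRange.mpr ⟨x, rfl⟩
  have hi₁ : Function.Bijective i₁ := by
    refine ⟨fun a b h => hφ (congrArg Subtype.val h), fun y => ?_⟩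
    obtain ⟨x, hx⟩ := RingHom.mem_fieldRange.mp (show (y : K) ∈ F₁ from y.2)
    exact ⟨x, Subtype.ext hx⟩
  let e₁ : F ≃+* F₁' := RingEquiv.ofBijective i₁ hi₁
  have hT1 : finrank F K = finrank F₁' K := by
    refine Algebra.finrank_eq_of_equiv_equiv e₁ (RingEquiv.refl K) ?_
    ext x
    rfl
  -- (T3) `[F : F^p] = [F₁' : F₀]`
  let i₀ : (frobenius F p).fieldRange →+* F₀ := (φ.comp (Subfield.subtype _)).codRestrict F₀ fun x => by
    obtain ⟨y, hy⟩ := RingHom.mem_fieldRange.mp x.2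
    exact RingHom.mem_fieldRange.mpr ⟨y, by rw [RingHom.comp_apply, RingHom.comp_apply, hy]; rfl⟩
  have hi₀ : Function.Bijective i₀ := by
    refine ⟨fun a b h => Subtype.ext (hφ (congrArg Subtype.val h)), fun z => ?_⟩
    obtain ⟨y, hy⟩ := RingHom.mem_fieldRange.mp z.2
    refine ⟨⟨frobenius F p y, RingHom.mem_fieldRange.mpr ⟨y, rfl⟩⟩, Subtype.ext ?_⟩
    rw [← hy]; rfl
  let e₀ : (frobenius F p).fieldRange ≃+* F₀ := RingEquiv.ofBijective i₀ hi₀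
  have hT3 : finrank (frobenius F p).fieldRange F = finrank F₀ F₁' := by
    refine Algebra.finrank_eq_of_equiv_equiv e₀ e₁ ?_
    ext x
    rfl
  -- (T4) `[K^p : F^p] = [K : F]` (Frobenius)
  let iφ : F →+* F₀ := (φ.comp (frobenius F p)).codRestrict F₀ fun x => RingHom.mem_fieldRange.mpr ⟨x, rfl⟩
  have hiφ : Function.Bijective iφ := by
    refine ⟨fun a b h => frobenius_inj F p (hφ (congrArg Subtype.val h)), fun z => ?_⟩
    obtain ⟨x, hx⟩ := RingHom.mem_fieldRange.mp z.2
    exact ⟨x, Subtype.ext hx⟩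
  let eφ : F ≃+* F₀ := RingEquiv.ofBijective iφ hiφ
  let jφ : K →+* Kp' := (frobenius K p).codRestrict Kp' fun x => RingHom.mem_fieldRange.mpr ⟨x, rfl⟩
  have hjφ : Function.Bijective jφ := by
    refine ⟨fun a b h => frobenius_inj K p (congrArg Subtype.val h), fun z => ?_⟩
    obtain ⟨x, hx⟩ := RingHom.mem_fieldRange.mp (show (z : K) ∈ Kp from z.2)
    exact ⟨x, Subtype.ext hx⟩
  let fφ : K ≃+* Kp' := RingEquiv.ofBijective jφ hjφ
  have hT4 : finrank F K = finrank F₀ Kp' := by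
    refine Algebra.finrank_eq_of_equiv_equiv eφ fφ ?_
    ext x
    show φ (frobenius F p x) = frobenius K p (φ x)
    rw [frobenius_def, hφp]
  -- (T2) `[K : K^p] = [K : Kp']` and the count
  have hT2 : finrank Kp K = finrank Kp' K := rfl
  have hn : 0 < finrank F K := finrank_pos
  rw [← hT4] at htower₂
  rw [← hT1] at htower₁
  rw [hT3, hT2]
  have h : finrank F₀ F₁' * finrank F K = finrank Kp' K * 1 * finrank F K := by
    rw [mul_one, htower₁, ← htower₂, mul_comm]
  rw [mul_one] at h
  exact Nat.eq_of_mul_eq_mul_right hn h.symm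

/-! ## §C `[K : K^p] = p^{r+3}` for the function field of a three-dimensional variety over a ground field with a `p`-basis of `r` elements -/

/-- **The count `[K : K^p] = p^{r+3}`**: `K = Frac A`, `A` a finitely generated algebra of Krull dimension `3` over a field `k` with a finite
`p`-basis `β` of `r` elements.  A transcendence basis `s` (three elements) gives `k(s) ⊆ K` finite, `[K : K^p] = [k(s) : k(s)^p]` (§A) and
`[k(s) : k(s)^p] = p^{r+3}` (§B).  No separability hypothesis on `K/k` (Mac Lane's function fields without separating transcendence bases
included). [cite: Matsumura1987, §26 Thm. 26.10] -/
theorem finrank_frobenius_eq_pow_of_pBasis {k K : Type} [Field k] [Field K] [Algebra k K] (p : ℕ) [Fact p.Prime] [CharP k p] [CharP K p]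
    (A : Subalgebra k K) (hAfg : A.FG) (hfrac : IsFractionRing A K) (hdim : ringKrullDim A = 3)
    {r : ℕ} (β : Fin r → k) (hβspan : IsPSpanningFamily p (pMonomial p β))
    (hβfree : ∀ i, β i ∉ Subfield.closure (Set.range (fun x : k => x ^ p) ∪ β '' ({i}ᶜ : Set (Fin r)))) :
    finrank (frobenius K p).fieldRange K = p ^ (r + 3) := by
  classical
  -- ### transcendence degree `3` and a transcendence basis of three elements
  haveI : Algebra.FiniteType k A := A.fg_iff_finiteType.mp hAfg
  haveI : Algebra.EssFiniteType A K := Algebra.EssFiniteType.of_isLocalization K (nonZeroDivisors A)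
  haveI : Algebra.EssFiniteType k K := Algebra.EssFiniteType.comp k A K
  obtain ⟨d, hd, htr⟩ := Literature.RingTheory.KrullDimension.exists_ringKrullDim_eq_and_trdeg_eq k A
  have hd3 : d = 3 := by
    rw [hd] at hdim
    exact_mod_cast hdim
  haveI : FaithfulSMul k A := (faithfulSMul_iff_algebraMap_injective k A).mpr (algebraMap k A).injective
  haveI : FaithfulSMul A K := (faithfulSMul_iff_algebraMap_injective A K).mpr (IsFractionRing.injective A K)
  haveI : Algebra.IsAlgebraic A K := IsLocalization.isAlgebraic K (nonZeroDivisors A)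
  have htrK : Algebra.trdeg k K = (3 : ℕ) := by
    rw [← trdeg_add_eq k A (A := K), trdeg_eq_zero (R := A) (A := K), add_zero, htr, hd3]
  obtain ⟨t, ht⟩ := exists_isTranscendenceBasis k K
  have hmk : Cardinal.mk t = (3 : ℕ) := by rw [ht.cardinalMk_eq_trdeg, htrK]
  have htfin : t.Finite := by
    rw [← Cardinal.lt_aleph0_iff_set_finite, hmk]
    exact Cardinal.natCast_lt_aleph0
  obtain ⟨s, hcoe⟩ : ∃ s : Finset K, (s : Set K) = t := ⟨htfin.toFinset, htfin.coe_toFinset⟩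
  subst hcoe
  have hcard : s.card = 3 := by
    have h : Cardinal.mk s = (3 : ℕ) := hmk
    rw [Cardinal.mk_coe_finset] at h
    exact_mod_cast h
  have hs : AlgebraicIndependent k ((↑) : s → K) := ht.1
  -- ### the purely transcendental subfield `F := k(s)` and `K/F` finite
  set F : IntermediateField k K := adjoin k (s : Set K) with hFdef
  haveI : CharP F p := (algebraMap F K).charP (algebraMap F K).injective p
  have halg : Algebra.IsAlgebraic F K := by
    have h := ht.isAlgebraic_field
    rwa [Subtype.range_coe] at h
  haveI := halg
  haveI : Algebra.EssFiniteType F K := Algebra.EssFiniteType.of_comp k F K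
  haveI : Module.Finite F K := Algebra.finite_of_essFiniteType_of_isAlgebraic
  -- ### `s` read inside `F`
  let ι : s → F := fun x => ⟨x.1, subset_adjoin k (s : Set K) (Finset.mem_coe.mpr x.2)⟩
  have hι : Function.Injective ι := fun a b h => Subtype.ext (congrArg (fun z : F => (z : K)) h)
  set sF : Finset F := Finset.univ.image ι with hsFdef
  have hsFcard : sF.card = 3 := by
    rw [hsFdef, Finset.card_image_of_injective _ hι, Finset.card_univ, ← hcard]
    exact Fintype.card_coe s
  have hval : ∀ y : sF, ((y : F) : K) ∈ s := by
    intro y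
    obtain ⟨x, _, hx⟩ := Finset.mem_image.mp y.2
    rw [← hx]
    exact x.2
  -- algebraic independence of `sF` over `k` inside `F`
  have hsF : AlgebraicIndependent k ((↑) : sF → F) := by
    have hinj : Function.Injective ((F.val : F →ₐ[k] K) ∘ ((↑) : sF → F)) := by
      intro a b h
      exact Subtype.ext (Subtype.ext h)
    have hrange : Set.range ((F.val : F →ₐ[k] K) ∘ ((↑) : sF → F)) ⊆ (s : Set K) := by
      rintro z ⟨y, rfl⟩
      exact hval y
    exact AlgebraicIndependent.of_comp F.val ((algebraicIndependent_subtype_range hinj).mp (hs.mono hrange))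
  -- `F = k(sF)` internally
  have himage : ((↑) : F → K) '' (sF : Set F) = (s : Set K) := by
    ext z
    constructor
    · rintro ⟨y, hy, rfl⟩
      exact hval ⟨y, hy⟩
    · intro hz
      exact ⟨ι ⟨z, hz⟩, Finset.mem_coe.mpr (Finset.mem_image.mpr ⟨⟨z, hz⟩, Finset.mem_univ _, rfl⟩), rfl⟩
  have htopF : adjoin k (sF : Set F) = ⊤ := by
    apply IntermediateField.lift_injective
    rw [lift_adjoin, lift_top, himage]
  -- ### count
  rw [finrank_frobenius_eq_of_finite p (F := F) (K := K),
    finrank_frobenius_purelyTranscendental p sF hsF htopF β hβspan hβfree, hsFcard]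


/-! ## §D THEOREM T⁗″: the slice over a ground field with a finite `p`-basis -/

/-- **THEOREM T⁗″'s slice**: `stub_cleanLU3DefectNonDiscrete` at `p` on {`[Γ : pΓ] = p²`, `k` with a finite `p`-BASIS `β` of `r` elements
(`k = k^p[β]`: the `p`-monomials of `β` `p`-span `k`, and `β` is `p`-free), `r` elements `w_i ∈ O_v` whose `p`-monomials are residually
`p`-independent} — i.e. (P2) with `[κ_v : κ_v^p] = [k : k^p] = p^r` (the residue field is NOT `p`-radically deficient).  No hypothesis on
`K/k` (separably generated or not) or on `κ_v/k` (separable, inseparable, infinite …); no count.  Binders through `hnd` are those of the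
lead's stub (token-identical with `CleanLU3DefectPRankTwoPMonAt`). [folklore] -/
def CleanLU3DefectPRankTwoPBasisAt (p : ℕ) : Prop :=
    ∀ (k : Type) [Field k] [CharP k p] (K : Type) [Field K] [Algebra k K]
    (O : ValuationSubring K) (A : Subalgebra k K), A.toSubring ≤ O.toSubring → A.FG → IsFractionRing A K →
    ringKrullDim A ≤ 3 → IsRegularLocalRing (locAtCentre A.toSubring O) →
    ringKrullDim (locAtCentre A.toSubring O) = 3 →
    (∀ (T : Subring K) (hT : T ≤ O.toSubring), A.toSubring ≤ T → (subringCentre T O hT).IsMaximal) →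
    ∀ g₀ : K, (∀ c : K, c ^ p ≠ g₀) →
    (∀ f₀ : K, ∃ f₁ : K, O.valuation (g₀ - f₁ ^ p) < O.valuation (g₀ - f₀ ^ p)) →
    (∀ hk : ∀ c : k, algebraMap k K c ∈ O, transcendenceDefect k O hk ≠ 0) →
    ¬ (∃ π : K, π ≠ 0 ∧ (∀ x : K, O.valuation x < 1 → O.valuation x ≤ O.valuation π) ∧
      (∀ x : K, x ≠ 0 → ∃ n : ℕ, O.valuation π ^ n ≤ O.valuation x)) →
    PRankTwoAt p O →
    ∀ (r : ℕ) (β : Fin r → k), IsPSpanningFamily p (pMonomial p β) →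
    (∀ i, β i ∉ Subfield.closure (Set.range (fun x : k => x ^ p) ∪ β '' ({i}ᶜ : Set (Fin r)))) →
    ∀ (w : Fin r → K), (∀ i, w i ∈ O) → ResiduallyPIndependentFamily p O (pMonomial p w) →
    CleanLUConcl p k K O A g₀

/-- **T⁗″ ⊂ T⁗′** (kernel): over a ground field with a `p`-basis of `r` elements the count `[K : K^p] = p^{r+3}` HOLDS (§C), so T⁗′ applies
with the `p`-spanning family `pMonomial p β`. [folklore] -/
theorem cleanLU3DefectPRankTwoPBasis_of_pMon (p : ℕ) [Fact p.Prime] (hPMon : CleanLU3DefectPRankTwoPMonAt p) :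
    CleanLU3DefectPRankTwoPBasisAt p := by
  intro k _ _ K _ _ O A hAO hAfg hFrac hdimA hreg hdim3 hzd g₀ hg₀ hdefect htd hnd hP2 r β hβspan hβfree w hwO hPI
  classical
  haveI : CharP K p := charP_of_injective_algebraMap (algebraMap k K).injective p
  have hdimA3 : ringKrullDim A = 3 := ringKrullDim_eq_three_of_locAtCentre O A hAO hdimA hdim3
  have hcount := finrank_frobenius_eq_pow_of_pBasis p A hAfg hFrac hdimA3 β hβspan hβfree
  have hcl : Subfield.closure (Set.range (fun x : K => x ^ p)) = (frobenius K p).fieldRange := by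
    apply le_antisymm
    · refine Subfield.closure_le.mpr ?_
      rintro z ⟨u, rfl⟩
      exact RingHom.mem_fieldRange.mpr ⟨u, frobenius_def ..⟩
    · intro z hz
      obtain ⟨u, rfl⟩ := RingHom.mem_fieldRange.mp hz
      exact Subfield.subset_closure ⟨u, (frobenius_def ..).symm⟩
  have hK : Module.finrank (Subfield.closure (Set.range (fun x : K => x ^ p))) K = p ^ (r + 3) := by
    rw [hcl]; exact hcount
  exact hPMon k K O A hAO hAfg hFrac hdimA hreg hdim3 hzd g₀ hg₀ hdefect htd hnd hP2 (Fin r → Fin p) (pMonomial p β) hβspan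
    r w hwO hPI hK

/-! ## §E `p`-monomials of a finite family: they span `E^p[β]`, and for a `p`-independent `β` they are linearly independent over `E^p` -/

section MonomialBasis

variable {E : Type} [Field E] (p : ℕ) [Fact p.Prime] [CharP E p]

omit [Fact p.Prime] [CharP E p] in
/-- `pMonomial` transported along a ring hom. [folklore] -/
theorem map_pMonomial {K L : Type} [Field K] [Field L] (f : K →+* L) {r : ℕ} (w : Fin r → K) (e : Fin r → Fin p) :
    f (pMonomial p w e) = pMonomial p (fun i => f (w i)) e := by
  simp [pMonomial, map_prod, map_pow]

omit [CharP E p] in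
/-- The product of two `p`-monomials is an `E^p`-multiple of a `p`-monomial (reduce exponents mod `p`). [folklore] -/
theorem pMonomial_mul_pMonomial {r : ℕ} (β : Fin r → E) (e e' : Fin r → Fin p) :
    ∃ c : E, pMonomial p β e * pMonomial p β e' =
      c ^ p * pMonomial p β (fun i => ⟨((e i : ℕ) + e' i) % p, Nat.mod_lt _ (Fact.out : p.Prime).pos⟩) := by
  refine ⟨∏ i, β i ^ (((e i : ℕ) + e' i) / p), ?_⟩
  simp only [pMonomial]
  rw [← Finset.prod_pow, ← Finset.prod_mul_distrib, ← Finset.prod_mul_distrib]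
  refine Finset.prod_congr rfl fun i _ => ?_
  rw [← pow_add, ← pow_mul, ← pow_add]
  congr 1
  rw [mul_comm]
  exact (Nat.div_add_mod _ _).symm

/-- Every element of `E^p[β]` (`= E^p(β)`, the `β i` being radical over `E^p`) is an `E^p`-linear combination of the `p`-monomials of `β`.
[cite: Matsumura1987, §26 p. 202] -/
theorem mem_span_pMonomial_of_mem_adjoin {r : ℕ} (β : Fin r → E) {x : E}
    (hx : x ∈ adjoin (frobenius E p).fieldRange (Set.range β)) :
    x ∈ Submodule.span (frobenius E p).fieldRange (Set.range (pMonomial p β)) := by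
  have hp : p.Prime := Fact.out
  set Ep : Subfield E := (frobenius E p).fieldRange
  set V : Submodule Ep E := Submodule.span Ep (Set.range (pMonomial p β))
  -- the generators are algebraic (radical) over `E^p`
  have halg : ∀ y ∈ Set.range β, IsAlgebraic Ep y := by
    rintro _ ⟨i, rfl⟩
    have hmem : β i ^ p ∈ (algebraMap Ep E).range := ⟨⟨β i ^ p, β i, rfl⟩, rfl⟩
    obtain ⟨a, ha⟩ := hmem
    refine ⟨Polynomial.X ^ p - Polynomial.C a, ?_, ?_⟩
    · exact Polynomial.X_pow_sub_C_ne_zero hp.pos a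
    · simp [ha]
  have hx' : x ∈ Algebra.adjoin Ep (Set.range β) := by
    rw [← adjoin_toSubalgebra_of_isAlgebraic halg]; exact hx
  clear hx
  -- the monomials contain `1` and the `β i`
  have hone : (1 : E) ∈ V := by
    have h1 : pMonomial p β (fun _ => ⟨0, hp.pos⟩) = 1 := by simp [pMonomial]
    exact h1 ▸ Submodule.subset_span ⟨_, rfl⟩
  have hβ : ∀ i, β i ∈ V := by
    intro i
    classical
    have h1 : pMonomial p β (fun j => if j = i then ⟨1, hp.one_lt⟩ else ⟨0, hp.pos⟩) = β i := by
      simp only [pMonomial]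
      rw [Finset.prod_eq_single i (fun j _ hj => by simp [hj]) (by simp)]
      simp
    exact h1 ▸ Submodule.subset_span ⟨_, rfl⟩
  -- `V` is closed under multiplication
  have key : ∀ e e', pMonomial p β e * pMonomial p β e' ∈ V := by
    intro e e'
    obtain ⟨c, hc⟩ := pMonomial_mul_pMonomial p β e e'
    rw [hc]
    have : (c ^ p : E) * pMonomial p β _ = (⟨c ^ p, c, rfl⟩ : Ep) • pMonomial p β
        (fun i => ⟨((e i : ℕ) + e' i) % p, Nat.mod_lt _ hp.pos⟩) := rfl
    rw [this]
    exact V.smul_mem _ (Submodule.subset_span ⟨_, rfl⟩)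
  have h1 : ∀ e, ∀ y ∈ V, pMonomial p β e * y ∈ V := by
    intro e y hy
    induction hy using Submodule.span_induction with
    | mem z hz => obtain ⟨e', rfl⟩ := hz; exact key e e'
    | zero => simp
    | add z w _ _ hz hw => rw [mul_add]; exact V.add_mem hz hw
    | smul a z _ hz => rw [mul_smul_comm]; exact V.smul_mem a hz
  have hmul : ∀ x' ∈ V, ∀ y ∈ V, x' * y ∈ V := by
    intro x' hx' y hy
    induction hx' using Submodule.span_induction with
    | mem z hz => obtain ⟨e, rfl⟩ := hz; exact h1 e y hy
    | zero => simp
    | add z w _ _ hz hw => rw [add_mul]; exact V.add_mem hz hw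
    | smul a z _ hz => rw [smul_mul_assoc]; exact V.smul_mem a hz
  induction hx' using Algebra.adjoin_induction with
  | mem z hz => obtain ⟨i, rfl⟩ := hz; exact hβ i
  | algebraMap a =>
    have : algebraMap Ep E a = a • (1 : E) := by rw [Algebra.smul_def, mul_one]
    rw [this]; exact V.smul_mem a hone
  | add z w _ _ hz hw => exact V.add_mem hz hw
  | mul z w _ _ hz hw => exact hmul z hz w hw

/-- The `p`-monomials of an injective `p`-independent family are linearly independent over `E^p`
(they span `E^p(β)`, of degree `p^r`, and there are `p^r` of them). [cite: Matsumura1987, §26 p. 202] -/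
theorem linearIndependent_pMonomial {r : ℕ} (β : Fin r → E) (hβ : Function.Injective β)
    (hPI : IsPIndependent (F := (frobenius E p).fieldRange) p (Set.range β)) :
    LinearIndependent (frobenius E p).fieldRange (pMonomial p β) := by
  classical
  have hp : p.Prime := Fact.out
  set Ep : Subfield E := (frobenius E p).fieldRange
  set L : IntermediateField Ep E := adjoin Ep (Set.range β)
  have hrange : ((Finset.univ.image β : Finset E) : Set E) = Set.range β := by
    rw [Finset.coe_image, Finset.coe_univ, Set.image_univ]
  have hL : finrank Ep L = p ^ r := by
    have h := hPI (Finset.univ.image β) hrange.le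
    rw [hrange, Finset.card_image_of_injective _ hβ, Finset.card_univ, Fintype.card_fin] at h
    exact h
  have hmemL : ∀ e, pMonomial p β e ∈ L := fun e =>
    prod_mem fun i _ => pow_mem (subset_adjoin Ep (Set.range β) (Set.mem_range_self i)) _
  let m : (Fin r → Fin p) → L := fun e => ⟨pMonomial p β e, hmemL e⟩
  have hspan : (⊤ : Submodule Ep L) ≤ Submodule.span Ep (Set.range m) := by
    rintro ⟨x, hxL⟩ -
    have hx := mem_span_pMonomial_of_mem_adjoin p β hxL
    have himage : Set.range (pMonomial p β) = (L.val.toLinearMap : L →ₗ[Ep] E) '' Set.range m := by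
      ext y; constructor
      · rintro ⟨e, rfl⟩; exact ⟨m e, ⟨e, rfl⟩, rfl⟩
      · rintro ⟨_, ⟨e, rfl⟩, rfl⟩; exact ⟨e, rfl⟩
    rw [himage, ← Submodule.map_span] at hx
    obtain ⟨y, hy, hyx⟩ := hx
    have : y = ⟨x, hxL⟩ := Subtype.ext hyx
    exact this ▸ hy
  have hcard : Fintype.card (Fin r → Fin p) = finrank Ep L := by
    rw [Fintype.card_fun, Fintype.card_fin, Fintype.card_fin, hL]
  have hli : LinearIndependent Ep m := linearIndependent_of_top_le_span_of_card_eq_finrank hspan hcard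
  have := hli.map' L.val.toLinearMap (LinearMap.ker_eq_bot.mpr Subtype.val_injective)
  exact this

end MonomialBasis

/-! ## §F From the `p`-degree to a `p`-basis: `[E : E^p] = p^r` gives an injective `p`-independent `β : Fin r → E` with `E = E^p(β)` -/

section PBasis

variable {E : Type} [Field E] (p : ℕ) [Fact p.Prime] [CharP E p]

/-- **A field of `p`-degree `p^r` has a `p`-basis with `r` elements.** [cite: Matsumura1987, §26 p. 202] -/
theorem exists_pBasis_of_finrank {r : ℕ} (h : finrank (frobenius E p).fieldRange E = p ^ r) :
    ∃ β : Fin r → E, Function.Injective β ∧ IsPIndependent (F := (frobenius E p).fieldRange) p (Set.range β) ∧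
      adjoin (frobenius E p).fieldRange (Set.range β) = ⊤ := by
  classical
  have hp : p.Prime := Fact.out
  set Ep : Subfield E := (frobenius E p).fieldRange
  haveI : FiniteDimensional Ep E := Module.finite_of_finrank_pos (by rw [h]; exact pow_pos hp.pos _)
  have hexp : ∀ x : E, x ^ p ∈ (algebraMap Ep E).range := fun x => ⟨⟨x ^ p, x, rfl⟩, rfl⟩
  obtain ⟨Γ, hΓ, htop⟩ := exists_isPIndependent_adjoin_eq_top Ep p hexp
  -- `Γ` is finite: a `p`-independent finite subset `t` has `[E^p(t) : E^p] = p^{#t} ≤ p^r`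
  have hbound : ∀ t : Finset E, (t : Set E) ⊆ Γ → t.card ≤ r := by
    intro t ht
    have h1 : finrank Ep (adjoin Ep (t : Set E)) ≤ finrank Ep E := by
      haveI : FiniteDimensional Ep (⊤ : IntermediateField Ep E) :=
        (IntermediateField.topEquiv (F := Ep) (E := E)).symm.toLinearEquiv.finiteDimensional
      have := IntermediateField.finrank_le_of_le_right (F := adjoin Ep (t : Set E)) (E := (⊤ : IntermediateField Ep E)) le_top
      rwa [finrank_top'] at this
    rw [hΓ t ht, h] at h1
    exact (Nat.pow_le_pow_iff_right hp.one_lt).mp h1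
  have hfin : Γ.Finite := by
    by_contra hinf
    obtain ⟨t, ht, hcard⟩ := Set.Infinite.exists_subset_card_eq hinf (r + 1)
    have := hbound t ht
    omega
  obtain ⟨t₀, rfl⟩ := hfin.exists_finset_coe
  have hcard : t₀.card = r := by
    have h1 := hΓ t₀ subset_rfl
    rw [htop, finrank_top', h] at h1
    exact (Nat.pow_right_injective hp.two_le h1).symm
  have hct : Fintype.card t₀ = r := by rw [Fintype.card_coe, hcard]
  let ε : t₀ ≃ Fin r := Fintype.equivFinOfCardEq hct
  refine ⟨fun i => (ε.symm i : E), ?_, ?_, ?_⟩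
  · intro i j hij
    exact ε.symm.injective (Subtype.ext hij)
  · have hr : Set.range (fun i => (ε.symm i : E)) = (t₀ : Set E) := by
      ext y; constructor
      · rintro ⟨i, rfl⟩; exact (ε.symm i).2
      · intro hy; exact ⟨ε ⟨y, hy⟩, by simp⟩
    rw [hr]; exact hΓ
  · have hr : Set.range (fun i => (ε.symm i : E)) = (t₀ : Set E) := by
      ext y; constructor
      · rintro ⟨i, rfl⟩; exact (ε.symm i).2
      · intro hy; exact ⟨ε ⟨y, hy⟩, by simp⟩
    rw [hr]; exact htop

/-- The subfield generated by the `p`-th powers and a set `S` is `E^p(S)`. [folklore] -/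
theorem closure_powers_union_eq (S : Set E) :
    Subfield.closure (Set.range (fun x : E => x ^ p) ∪ S) = (adjoin (frobenius E p).fieldRange S).toSubfield := by
  rw [adjoin_toSubfield]
  congr 2
  ext y; constructor
  · rintro ⟨x, rfl⟩; exact ⟨⟨x ^ p, x, rfl⟩, rfl⟩
  · rintro ⟨⟨_, x, rfl⟩, rfl⟩; exact ⟨x, rfl⟩

/-- **`k`-side data from the `p`-degree**: `[k : k^p] = p^r` yields `β : Fin r → k` whose `p`-monomials `p`-span `k` and which is `p`-free.
[cite: Matsumura1987, §26 p. 202] -/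
theorem exists_pSpanning_pFree_of_finrank {r : ℕ} (h : finrank (frobenius E p).fieldRange E = p ^ r) :
    ∃ β : Fin r → E, IsPSpanningFamily p (pMonomial p β) ∧
      ∀ i, β i ∉ Subfield.closure (Set.range (fun x : E => x ^ p) ∪ β '' ({i}ᶜ : Set (Fin r))) := by
  classical
  have hp : p.Prime := Fact.out
  set Ep : Subfield E := (frobenius E p).fieldRange
  obtain ⟨β, hβinj, hPI, htop⟩ := exists_pBasis_of_finrank p h
  refine ⟨β, ?_, ?_⟩
  · intro c
    have hc : c ∈ adjoin Ep (Set.range β) := by rw [htop]; exact mem_top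
    have hspan := mem_span_pMonomial_of_mem_adjoin p β hc
    obtain ⟨a, ha⟩ := Submodule.mem_span_range_iff_exists_fun Ep |>.mp hspan
    choose d hd using fun e => RingHom.mem_fieldRange.mp (a e).2
    refine ⟨d, ?_⟩
    rw [← ha]
    refine Finset.sum_congr rfl fun e _ => ?_
    rw [Subfield.smul_def, smul_eq_mul, ← hd e, frobenius_def]
  · intro i hi
    rw [closure_powers_union_eq p] at hi
    change β i ∈ adjoin Ep (β '' ({i}ᶜ : Set (Fin r))) at hi
    -- `E^p(β i) ∩ E^p(β '' {i}ᶜ) = E^p` by `p`-independence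
    have hs : (({β i} : Finset E) : Set E) ⊆ Set.range β := by simp
    have ht : ((Finset.univ.image β).erase (β i) : Set E) = β '' ({i}ᶜ : Set (Fin r)) := by
      ext y
      simp only [Finset.coe_erase, Finset.coe_image, Finset.coe_univ, Set.image_univ, Set.mem_sdiff, Set.mem_range,
        Set.mem_singleton_iff, Set.mem_image, Set.mem_compl_iff]
      constructor
      · rintro ⟨⟨j, rfl⟩, hne⟩; exact ⟨j, fun hji => hne (by rw [hji]), rfl⟩
      · rintro ⟨j, hji, rfl⟩; exact ⟨⟨j, rfl⟩, fun heq => hji (hβinj heq)⟩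
    have ht' : (((Finset.univ.image β).erase (β i) : Finset E) : Set E) ⊆ Set.range β := by
      rw [ht]; rintro _ ⟨j, _, rfl⟩; exact ⟨j, rfl⟩
    have hdisj : Disjoint ({β i} : Finset E) ((Finset.univ.image β).erase (β i)) := by
      rw [Finset.disjoint_singleton_left]; exact Finset.notMem_erase _ _
    have hbot := adjoin_inf_adjoin_eq_bot_of_isPIndependent hPI {β i} ((Finset.univ.image β).erase (β i)) hs ht' hdisj
    have hmem : β i ∈ adjoin Ep (({β i} : Finset E) : Set E) ⊓ adjoin Ep (((Finset.univ.image β).erase (β i) : Finset E) : Set E) := by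
      refine ⟨subset_adjoin Ep _ (by simp), ?_⟩
      rw [ht]; exact hi
    rw [hbot] at hmem
    -- so `E^p(β i) = E^p`, of degree `1 ≠ p`
    have h1 : finrank Ep (adjoin Ep (({β i} : Finset E) : Set E)) = p ^ 1 := by
      rw [hPI {β i} hs, Finset.card_singleton]
    have h2 : adjoin Ep (({β i} : Finset E) : Set E) = ⊥ := by
      rw [Finset.coe_singleton]; exact adjoin_simple_eq_bot_iff.mpr hmem
    rw [h2, IntermediateField.finrank_bot, pow_one] at h1
    exact hp.one_lt.ne h1

/-- The subfield generated by the `p`-th powers is the range of Frobenius. [folklore] -/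
theorem closure_range_pow_eq_fieldRange :
    Subfield.closure (Set.range (fun x : E => x ^ p)) = (frobenius E p).fieldRange := by
  apply le_antisymm
  · refine Subfield.closure_le.mpr ?_
    rintro z ⟨u, rfl⟩
    exact RingHom.mem_fieldRange.mpr ⟨u, frobenius_def ..⟩
  · intro z hz
    obtain ⟨u, rfl⟩ := RingHom.mem_fieldRange.mp hz
    exact Subfield.subset_closure ⟨u, (frobenius_def ..).symm⟩

end PBasis

/-! ## §G The residual side: `[κ_v : κ_v^p] = p^r` gives `r` elements of `O_v` with residually `p`-independent `p`-monomials -/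

section Residual

variable {K : Type} [Field K] (p : ℕ) [Fact p.Prime] (O : ValuationSubring K) [CharP (ResidueField O) p]

/-- **`κ`-side data from the residual `p`-degree**: lifts `w_i ∈ O_v` of a `p`-basis of `κ_v` over `κ_v^p` have residually
`p`-independent `p`-monomials (the residue of `Σ_e w'_e^p W_e` is `Σ_e w̄'_e^p · β̄^e`, and the `β̄^e` are `κ_v^p`-linearly independent).
[cite: Matsumura1987, §26 p. 202] -/
theorem exists_residuallyPIndependent_of_finrank {r : ℕ}
    (h : finrank (frobenius (ResidueField O) p).fieldRange (ResidueField O) = p ^ r) :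
    ∃ w : Fin r → K, (∀ i, w i ∈ O) ∧ ResiduallyPIndependentFamily p O (pMonomial p w) := by
  classical
  have hp : p.Prime := Fact.out
  obtain ⟨βbar, hinj, hPI, -⟩ := exists_pBasis_of_finrank p h
  have hli := linearIndependent_pMonomial p βbar hinj hPI
  choose w₀ hw₀ using fun i => residue_surjective (βbar i)
  refine ⟨fun i => (w₀ i : K), fun i => (w₀ i).2, ?_⟩
  intro w' hw' he
  obtain ⟨e₀, he₀⟩ := he
  set ω : (Fin r → Fin p) → O := fun e => ⟨w' e, hw' e⟩
  set sO : O := ∑ e, ω e ^ p * ∏ i, w₀ i ^ ((e i : Fin p) : ℕ)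
  have hcoe : (sO : K) = ∑ e, w' e ^ p * pMonomial p (fun i => (w₀ i : K)) e := by
    simp [sO, ω, pMonomial]
  rw [← hcoe]
  refine (O.valuation_eq_one_iff sO).mp ?_
  by_contra hnu
  have hres : residue O sO = 0 := (residue_eq_zero_iff _).mpr ((IsLocalRing.mem_maximalIdeal _).mpr hnu)
  have hsum : residue O sO = ∑ e, (residue O (ω e)) ^ p * pMonomial p βbar e := by
    simp only [sO, map_sum, map_mul, map_pow, map_prod, pMonomial, hw₀]
  -- a linear relation among the `p`-monomials of `β̄` with coefficients in `κ^p`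
  let c : (Fin r → Fin p) → (frobenius (ResidueField O) p).fieldRange :=
    fun e => ⟨residue O (ω e) ^ p, residue O (ω e), rfl⟩
  have hrel : ∑ e, c e • pMonomial p βbar e = 0 := by
    rw [← hres, hsum]
    refine Finset.sum_congr rfl fun e _ => ?_
    rw [Subfield.smul_def, smul_eq_mul]
  have hc := (Fintype.linearIndependent_iff.mp hli) c hrel e₀
  have hc' : residue O (ω e₀) ^ p = 0 := by
    have := congrArg Subtype.val hc
    simpa only [c, ZeroMemClass.coe_zero] using this
  have hω : residue O (ω e₀) = 0 := pow_eq_zero_iff hp.ne_zero |>.mp hc'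
  have hunit : IsUnit (ω e₀) := (O.valuation_eq_one_iff (ω e₀)).mpr he₀
  exact ((residue_ne_zero_iff_isUnit _).mpr hunit) hω

end Residual

/-! ## §H THE CANONICAL SLICE (THEOREM T⁗‴): (P2) ∧ `[k : k^p] = p^r` ∧ `[κ_v : κ_v^p] = p^r` — the two `p`-degrees, no frame data -/

/-- **THEOREM T⁗‴'s slice (canonical hypotheses)**: `stub_cleanLU3DefectNonDiscrete` at `p` on {`[Γ : pΓ] = p²`, `[k : k^p] = p^r`,
`[κ_v : κ_v^p] = p^r`} — the value group mod `p` and the two `p`-DEGREES (finranks over the subfields of `p`-th powers of `k` and of the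
residue field `κ_v = O_v/𝔪_v`), nothing else: no frame, no `p`-basis, no count, no hypothesis on `K/k` or `κ_v/k`.  Under :279's `hzd`
(`κ_v/k` algebraic) `[κ_v : κ_v^p] ≤ [k : k^p]` always, so this is «(P2) and the residue field is NOT `p`-radically deficient» = the slice of
MINIMAL DEFECT `d(K|K^p, v) = p` (memo §27).  Binders through `hnd` token-identical with `CleanLU3DefectPRankTwoPMonAt`. [folklore] -/
def CleanLU3DefectPRankTwoPDegAt (p : ℕ) : Prop :=
    ∀ (k : Type) [Field k] [CharP k p] (K : Type) [Field K] [Algebra k K]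
    (O : ValuationSubring K) (A : Subalgebra k K), A.toSubring ≤ O.toSubring → A.FG → IsFractionRing A K →
    ringKrullDim A ≤ 3 → IsRegularLocalRing (locAtCentre A.toSubring O) →
    ringKrullDim (locAtCentre A.toSubring O) = 3 →
    (∀ (T : Subring K) (hT : T ≤ O.toSubring), A.toSubring ≤ T → (subringCentre T O hT).IsMaximal) →
    ∀ g₀ : K, (∀ c : K, c ^ p ≠ g₀) →
    (∀ f₀ : K, ∃ f₁ : K, O.valuation (g₀ - f₁ ^ p) < O.valuation (g₀ - f₀ ^ p)) →
    (∀ hk : ∀ c : k, algebraMap k K c ∈ O, transcendenceDefect k O hk ≠ 0) →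
    ¬ (∃ π : K, π ≠ 0 ∧ (∀ x : K, O.valuation x < 1 → O.valuation x ≤ O.valuation π) ∧
      (∀ x : K, x ≠ 0 → ∃ n : ℕ, O.valuation π ^ n ≤ O.valuation x)) →
    PRankTwoAt p O →
    ∀ r : ℕ, Module.finrank (Subfield.closure (Set.range (fun x : k => x ^ p))) k = p ^ r →
    Module.finrank (Subfield.closure (Set.range (fun x : IsLocalRing.ResidueField O => x ^ p))) (IsLocalRing.ResidueField O) = p ^ r →
    CleanLUConcl p k K O A g₀

/-- **T⁗‴ ⊂ T⁗″** (kernel): the `p`-degrees produce the data — a `p`-basis `β` of `k` (`p`-monomials `p`-span, `β` `p`-free; §F) and lifts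
`w_i ∈ O_v` of a `p`-basis of `κ_v` with residually `p`-independent `p`-monomials (§G). [folklore] -/
theorem cleanLU3DefectPRankTwoPDeg_of_pBasis (p : ℕ) [Fact p.Prime] (hPB : CleanLU3DefectPRankTwoPBasisAt p) :
    CleanLU3DefectPRankTwoPDegAt p := by
  intro k _ _ K _ _ O A hAO hAfg hFrac hdimA hreg hdim3 hzd g₀ hg₀ hdefect htd hnd hP2 r hk hκ
  classical
  have hkO : ∀ c : k, algebraMap k K c ∈ O := fun c => hAO (A.algebraMap_mem c)
  let f : k →+* IsLocalRing.ResidueField O := (IsLocalRing.residue O).comp ((algebraMap k K).codRestrict O hkO)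
  haveI : CharP (IsLocalRing.ResidueField O) p := (f.charP_iff_charP p).mp inferInstance
  rw [closure_range_pow_eq_fieldRange (E := k) p] at hk
  rw [closure_range_pow_eq_fieldRange (E := IsLocalRing.ResidueField O) p] at hκ
  obtain ⟨β, hβspan, hβfree⟩ := exists_pSpanning_pFree_of_finrank p hk
  obtain ⟨w, hwO, hRPI⟩ := exists_residuallyPIndependent_of_finrank p O hκ
  exact hPB k K O A hAO hAfg hFrac hdimA hreg hdim3 hzd g₀ hg₀ hdefect htd hnd hP2 r β hβspan hβfree w hwO hRPI

/-- **T⁗‴ ⊂ T⁗′** (kernel, composing with §D): from T⁗′'s `p`-monomial-frame slice. At port time this composes further with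
`cleanLU3DefectPRankTwoPMon_of_cossartPiltant2019` (`Lens5_TFrame.lean` §I) to give the canonical slice modulo F-02/F-32 only. [folklore] -/
theorem cleanLU3DefectPRankTwoPDeg_of_pMon (p : ℕ) [Fact p.Prime] (hPMon : CleanLU3DefectPRankTwoPMonAt p) :
    CleanLU3DefectPRankTwoPDegAt p :=
  cleanLU3DefectPRankTwoPDeg_of_pBasis p (cleanLU3DefectPRankTwoPBasis_of_pMon p hPMon)

end Summit.ResolutionOfSingularities.ResolutionOfSingularities.Cruxes.DescentPerfectToAll.CpSibling.PDegreeCount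

end

end
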